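import Literature.Topology.PlaneTopology.ChartParity
import Literature.Topology.PlaneTopology.JordanWindingOne
import HarnessLib

/-!
# The orientation parity of a planar chart is `±1`

Topic: Topology / PlaneTopology, sequel to `ChartParity.lean` (the parity of a chart of a planar
domain: the winding number about `ι x` of the image of the unit circle of the chart about `e x`,
shown non-zero there) and `JordanWindingOne.lean` (a Jordan loop winds `±1` times about the points
of its inside). The chart loop is a Jordan loop and `ι x` lies inside it (its winding number is
non-zero), so **the parity is `1` or `-1`** (`parity_eq_one_or_neg_one`): the `C⁰` chart is
orientation preserving or reversing, with local degree `±1`.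

* `isJordanLoop_chartLoop`, `mem_inside_chartLoop` (**proved**);
* `parity_eq_one_or_neg_one` (**proved**).

All statements are [folklore].
-/

noncomputable section

open Set Function
open _root_.Topology

namespace Literature.Topology.PlaneTopology

variable {X : Type*} [TopologicalSpace X] {ι : X → ℂ} {e : OpenPartialHomeomorph X (ℝ × ℝ)} {x : X} {ρ : ℝ}

/-- The chart loop of non-zero radius is a Jordan loop. [folklore] -/
theorem isJordanLoop_chartLoop (hιc : Continuous ι) (hι : Injective ι) (he : e.target = univ) (x : X) (hρ : ρ ≠ 0) :
    IsJordanLoop (chartLoop ι e x ρ) :=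
  ⟨continuous_chartLoop hιc he x ρ, periodic_chartLoop x ρ, injOn_chartLoop hι he x hρ⟩

/-- **`ι x` lies inside the unit chart loop about `x`.** [folklore] -/
theorem mem_inside_chartLoop (hι : IsOpenEmbedding ι) (he : e.target = univ) (hx : x ∈ e.source) :
    ι x ∈ IsJordanLoop.inside (chartLoop ι e x 1) := by
  have hJ := isJordanLoop_chartLoop hι.continuous hι.injective he x one_ne_zero
  have hr : ι x ∉ range (chartLoop ι e x 1) := by
    rintro ⟨t, ht⟩; exact chartLoop_ne hι.injective he hx one_ne_zero t ht
  exact (hJ.mem_inside_iff_wind_ne_zero hr).2 (parity_ne_zero hι he hx)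

/-- **The parity of a planar chart is `±1`.** [folklore] -/
theorem parity_eq_one_or_neg_one (hι : IsOpenEmbedding ι) (he : e.target = univ) (hx : x ∈ e.source) :
    parity ι e x = 1 ∨ parity ι e x = -1 :=
  (isJordanLoop_chartLoop hι.continuous hι.injective he x one_ne_zero).wind_eq_one_or_neg_one_of_mem_inside
    (mem_inside_chartLoop hι he hx)

end Literature.Topology.PlaneTopology
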